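import Summits.BirchSwinnertonDyer.BirchSwinnertonDyer.Theorems.SignedLowerHalvesKobayashiMainConjectureSmallImageSignedMuOneSign
import Summits.BirchSwinnertonDyer.BirchSwinnertonDyer.Theorems.SmallImageMuTransferMuTransferStubX9MuBookkeeping
import Summits.BirchSwinnertonDyer.BirchSwinnertonDyer.Theorems.SignedLowerHalvesKobayashiMainConjectureSmallImageSelfTwistNotSurjective
import Summits.BirchSwinnertonDyer.BirchSwinnertonDyer.Theorems.Rank1ResidualX11RankOneReduction
import Summits.BirchSwinnertonDyer.Rank1Residual.Supersingular.MazurTateCertificates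
import Summits.BirchSwinnertonDyer.Rank1Residual.Supersingular.NonsplitCartanThreeDescentRecordsX7Three03
import Summits.BirchSwinnertonDyer.Rank1Residual.Supersingular.NonsplitCartanThreeDescentRecordsX7Three04
import Summits.BirchSwinnertonDyer.Rank1Residual.Supersingular.NonsplitCartanThreeDescentRecordsX7Three05
import Summits.BirchSwinnertonDyer.Rank1Residual.Supersingular.NonsplitCartanThreeDescentRecordsX7Three06
import Literature.NumberTheory.EllipticCurves.ComplexMultiplicationLocalFactorsAux
import Literature.NumberTheory.EllipticCurves.PointCountEulerCriterion
import HarnessLib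

/-!
# Route `SignedLowerHalves`, crux `KobayashiMainConjectureSmallImage` (item stmt-BirchSwinnertonDyer-19002) —
# «L4X-REKEY-NF»: PARTNER-FREE records of Kobayashi's `±` main conjecture, BOTH signs, for the nine rank-`0`
# NEWFORM-partnered item-4 pairs @ 3 that carry a flag-free `bsdp3_nn<label>` door, through lane B's refereed
# Euler-system `μ`-transfer (`SmallImageSignedMuTransfer.signed_lengthAt_le_of_hasUnitContent_anySign`, p533653) composed with
# lane A's rank-`0` door (`kobayashiMainConjecture_of_mu_eq_zero_of_bsdp_of_analyticRank_eq_zero`, p447454) — i.e. lane B's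
# F3 §3 door (p532179) re-assembled ROUTE-INDEPENDENTLY (no `Theses` import) — fed with E's OWN two-engine Mazur–Tate rows
# (cell `bsd-ssimc`, seat `bsd-ssimc-k3-c4` gen 14, part F2; planner D31-35/D31-38; `--supports … --as helper`; theorems only)

HONEST FRAMING: Kobayashi's signed main conjecture at a non-surjective (normaliser-of-non-split-Cartan) image is OPEN
as a class statement; item 4 stays OPEN; nothing here is booked; BSD is not proved by any of this.  These are PER-PAIR
theorems, CONDITIONAL on the displayed binders: lane B's tuple EXACTLY — the ONE construction fact
`Kobayashi2003.thm62_63_73_signedColemanKato_zeta` (`hCK`, p529649, reviewed) and the PUBLISHED facts `h12`, `h41`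
(rational clause), `hKim` (B. D. Kim 2013 Cor. 3.15), `h5`/`h3` (period units), `hGZK`, `hmod'` — plus per pair the
DISPLAYED data: Cremona's `r_an = 0`, `#Ш_an` a `3`-unit and the EXACT two-engine `3`-descent line `hSel` (the binders
of the b2b door `bsdp3_nn<label>`, passed through, never re-proved or hidden), the newform `f₀` of `E`, and ONE
Mazur–Tate row per sign.  NO partner, NO congruence, NO preprint, NO `Surj`, NO GRH.  The image datum
`¬ W.HasSurjectiveModNGaloisRep 3` is a KERNEL theorem (`SmallImageSelfTwist.not_surj_three_c<label>`, part F1, from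
the seat's gen-10 self-twist certificates) — no Cremona image label is displayed.

## The rows (kit j280059, `--tag bsd --workitem stmt-BirchSwinnertonDyer-19002`; memo `HOME/k3c4-MEMO-13.md`)

For each pair the EVEN row is Pollack's `θ₄(f₀)` (engine level `n = 5`; `deg ω₄⁻ = φ(3) + φ(27) = 20`) and the ODD row
is `θ₅(f₀)` (engine level `n = 6`; `deg ω₅⁺ = φ(9) + φ(81) = 60`): `Θ ≠ 0`, `μ(Θ) = 0`, `λ(Θ) = deg ω + l`.  Engine B =
the cell's PARI-free msengine (lit-g7) + `iwlayer.py` d2ade7e3 + `runB.py` b921e851 BYTE-IDENTICAL to kit j279021 /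
j275540, run at `JOB_NPOL = 3:6`; engine E = Cremona's eclib EXACT modular symbols through Sage (`sage -c runpy`,
`exact_eclib.py` dffee41f byte-identical to j279021's), fed through the SAME `iwlayer.theta_data`.  A row is displayed
only where B = E identically at that layer and the reading is STABLE (`(μ, λ − q)` at `θ₄` = at `θ₂`, at `θ₅` = at `θ₃`);
the memo prints all six layers for both engines (result: B = E identically on `(μ, λ)` at EVERY layer of EVERY pair).
Normalisation: engine B uses the Néron period `Ω_E` (both real components; `[0]⁺ = L(E,1)/Ω_E = ∏c_ℓ/#E(ℚ)_tors²`, checked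
per pair against the job's PARI header), engine E eclib's least real period (`= Ω_E/2` on the six curves with `Δ > 0`, so its
table is `2×` B's there — a `3`-adic unit); the tree's `θ_n(f₀)` is `Ω⁺_{f₀}`-normalised and `Ω_E/Ω⁺_{f₀}` is a `3`-adic unit
by `h3` (E[3] irreducible, `3 ∤ N`); so `(μ, λ)` are the same in all three normalisations.
At rank `0` the rows also say `λ(L_3^ε(E)) = l ≥ 1` for both signs, consistent with `3 ∣ L(E,1)/Ω_E = ∏ c_ℓ / #tors²`
(Kobayashi (3.6): `L^ε(0) = c_ε·[0]⁺`, `c_± = 2` at `p = 3`).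

## Contents

* §1 `kobayashiMainConjecture_of_signedMuCert_of_bsdp_of_analyticRank_eq_zero` — the rank-`0` partner-free door in
  CERTIFICATE currency: `μ(L) = 0` for every `L` with `IsSignedPAdicLFunction f p ε L` (e.g. from ONE Mazur–Tate row
  through `lam_signed_{one,neg_one}_eq_of_mazurTate'`) ⟹ `KobayashiMainConjecture W p ε`; the period ratio `ϖ` from
  `h5`/`h3`, Pollack's `L^ε ≠ 0` from `pollack_exists_plusMinusPAdicLFunction_holds` (PROVED), unit content by Gauss,
  `μ(X^ε) = 0` from p533653's length bound at `(p)`, then p447454.  Route-independent (the file imports no `Theses`).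
* §2 kernel point counts `#Ẽ(𝔽_3) = 4` (`a_3 = 0`) for the nine Cremona models.
* §3 the nine records `nf_kobayashiMainConjecture_<label>_3 : ∀ ε, KobayashiMainConjecture W 3 ε`.

PARTITION (cell bsd-ssimc): X7 (A7) × the nine rank-0 newform-partnered item-4 pairs @ 3 with a `bsdp3_nn` door —
types-the-object-of (per-pair `∀ ε` MC records at the «construction fact + published + certificates» tier; the desk
cells `(3, X7)` of these labels are PROVED already); closes NONE; 0 desk cells; item-4 MC-record coverage 115 → 124 / 136.

References: [Kobayashi2003] Conj. (p. 2), Thm. 1.2, 4.1, (3.6), 6.2, 6.3, 7.3; [Kato2004Asterisque] Thm. 12.6, §13.8;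
[BDKim2013] Cor. 3.15; [Pollack2003] Prop. 6.9, 6.10, 6.18, Def. 6.15; [GreenbergVatsal2000] (2), §3 Rem. 3.4;
[Miller2011LMS] Def. 1.1; [SchaeferStoll2004]; [Serre1972] §4.5; [Fisher2012Hessian] Thm. 13.2; [Cremona2006] Table 1.
-/

set_option autoImplicit false
set_option linter.dupNamespace false

noncomputable section

open scoped Classical MatrixGroups ModularForm

open CongruenceSubgroup WeierstrassCurve Field Literature.NumberTheory.EllipticCurves
  Literature.NumberTheory.EllipticCurves.ModularForms
  Literature.NumberTheory.EllipticCurves.Kobayashi2003 Literature.NumberTheory.EllipticCurves.Kato2004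
  Literature.NumberTheory.EllipticCurves.GreenbergVatsal2000 ZpExtension
  Literature.NumberTheory.EllipticCurves.Module
  Literature.NumberTheory.EllipticCurves.Rank1Residual
  Literature.NumberTheory.EllipticCurves.Rank1Residual.Typed
  Literature.NumberTheory.EllipticCurves.Rank1Residual.X11RankOneCertificates
  Summit.BirchSwinnertonDyer.Rank1Residual.X1.MuLambda
  Summit.BirchSwinnertonDyer.Rank1Residual.Supersingular
  Summit.BirchSwinnertonDyer.Rank1Residual.X11b
  Summit.BirchSwinnertonDyer.BirchSwinnertonDyer.Rank1Residual
  Summit.BirchSwinnertonDyer.BirchSwinnertonDyer.Rank1Residual.IntModel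
  Summit.BirchSwinnertonDyer.BirchSwinnertonDyer.Rank1Residual.X11RankOne
  Summit.BirchSwinnertonDyer.BirchSwinnertonDyer.Theorems.SmallImageSignedMuTransfer

namespace Summit.BirchSwinnertonDyer.BirchSwinnertonDyer.Theorems.SmallImageSignedMuNF

/-! ### §1 The partner-free rank-`0` door in certificate currency -/

/-- **Kobayashi's main conjecture for `(E, p, ε)` at rank `0`, small image, PARTNER-FREE, from a `μ`-certificate for
`L_p^ε(E)`.**  Let `p` be an odd good prime of `E = W` with `a_p = 0` and `ρ̄_{E,p}` NOT onto, `f` a newform of `W`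
(any level), `r_an(E) = 0` and `BSD(E,p)`; suppose every `L ∈ Λ` with `IsSignedPAdicLFunction f p ε L` has `μ(L) = 0`
(`hcert` — discharged per pair by ONE Mazur–Tate row of parity `ε` via `lam_signed_{one,neg_one}_eq_of_mazurTate'`).
Then `KobayashiMainConjecture W p ε`.  Assembly (= lane B's F3 §3 door p532179, rebuilt from route-independent parts):
`ϖ = u⁻¹` with `Ω_E = u·Ω⁺_f`, `‖u‖_p = 1` (`h5` for `p ≥ 5` / `h3` for `p = 3`, under `Irr` at a supersingular odd `p`);
Pollack's `L^ε ≠ 0` (`pollack_exists_plusMinusPAdicLFunction_holds`, PROVED); `μ(L^ε) = 0 ⟹` unit content (Gauss);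
lane B's INTEGRAL length bound `length_(p) X^ε ≤ length_(p) Λ/(L^ε) = 0`
(`SmallImageSignedMuTransfer.signed_lengthAt_le_of_hasUnitContent_anySign`, p533653, with `ε₀ = ε`; the construction
fact `hCK`) ⟹ `μ(X^ε(E/ℚ_∞)) = 0` for every dual datum; lane A's rank-`0` door
`kobayashiMainConjecture_of_mu_eq_zero_of_bsdp_of_analyticRank_eq_zero` (p447454).  Binders `hCK h12 h41 hKim h5 h3 hGZK
hmod'` BY NAME (= F3's tuple); `hns`, `h0`, `hB`, `hcert` per pair.  CONDITIONAL; per pair; nothing booked.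
[cite: Kobayashi2003, Thm. 1.2 (p. 2), Thm. 4.1 (p. 8), (3.6) (p. 7), Thm. 6.3 (p. 11), Thm. 7.3 (p. 13)]
[cite: Pollack2003, Thm. 5.1 and Prop. 6.18] [cite: BDKim2013, Cor. 3.15 (p. 199)] [cite: GreenbergVatsal2000, §3 Remark 3.4 and p. 2 (2)] -/
theorem kobayashiMainConjecture_of_signedMuCert_of_bsdp_of_analyticRank_eq_zero
    (hCK : thm62_63_73_signedColemanKato_zeta)
    (h12 : Kobayashi2003.thm12_signedSelmerDual_finite_torsion)
    (h41 : Kobayashi2003.thm41_signedCharIdeal_divisibility)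
    (hKim : BDKim2013.cor315_signedCharValue_rankZero)
    (h5 : realPeriodRat_eq_unit_mul_plusPeriod) (h3 : realPeriodRat_eq_unit_mul_plusPeriod_three)
    (hGZK : rank_eq_analyticRank_of_analyticRank_le_one) (hmod' : hasEntireLFunction_rat)
    (W : WeierstrassCurve ℚ) [W.IsElliptic] [W.IsGloballyMinimal] (p : ℕ) [Fact p.Prime]
    (hp : p ≠ 2) (hgood : W.HasGoodReductionAtPrime p) (hap : W.frobeniusTrace p = 0)
    (hns : ¬ W.HasSurjectiveModNGaloisRep p)
    {N : ℕ} [NeZero N] {f : CuspForm (Gamma0 N) 2} (hf : IsNewformOf W f) (ε : ℤˣ)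
    (hcert : ∀ L : IwasawaAlgebra p, IsSignedPAdicLFunction f p ε L → mu L = 0)
    (h0 : W.analyticRank = 0) (hB : BSDp W p) : KobayashiMainConjecture W p ε := by
  have hpP : p.Prime := Fact.out
  -- `E[p]` irreducible at a supersingular odd prime
  have hirr : W.HasIrreducibleModPGaloisRep p :=
    hasIrreducibleModPGaloisRep_of_dvd_frobeniusTrace W p hp
      (W.not_dvd_minimalDiscriminantInt_of_hasGoodReductionAtPrime' p hgood) (by rw [hap]; exact dvd_zero _)
  -- the period ratio `ϖ` with `ϖ · Ω_E = Ω⁺_f` (from `h5` / `h3`)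
  have hu : ∃ u : ℚ, ‖(u : ℚ_[p])‖ = 1 ∧ W.realPeriodRat = u * plusPeriod f := by
    by_cases hp3 : p = 3
    · subst hp3
      exact h3 W hgood hirr f hf
    · exact h5 W p (hpP.five_le_of_ne_two_of_ne_three hp hp3) hgood hirr f hf
  obtain ⟨u, hu1, hu⟩ := hu
  have hu0 : u ≠ 0 := by
    rintro rfl
    simp at hu1
  have hϖ : ((u⁻¹ : ℚ) : ℝ) * W.realPeriodRat = plusPeriod f := by
    rw [hu, Rat.cast_inv, ← mul_assoc, inv_mul_cancel₀ (Rat.cast_ne_zero.mpr hu0), one_mul]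
  -- Pollack's signed `p`-adic `L`-function for the sign `ε`: non-zero, `μ = 0` by the certificate, unit content
  obtain ⟨Lplus, Lminus, hLp0, hLm0, hodd, heven⟩ :=
    pollack_exists_plusMinusPAdicLFunction_holds (W := W) (f := f) (p := p) hp hf hgood hap
  have hL : ∃ L : IwasawaAlgebra p, L ≠ 0 ∧ IsSignedPAdicLFunction f p ε L := by
    rcases Int.units_eq_one_or ε with rfl | rfl
    · exact ⟨Lminus, hLm0, (isSignedPAdicLFunction_one_iff f p Lminus).mpr heven⟩
    · exact ⟨Lplus, hLp0, (isSignedPAdicLFunction_neg_one_iff f p Lplus).mpr hodd⟩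
  obtain ⟨L, hL0, hL⟩ := hL
  have hμ : mu L = 0 := hcert L hL
  have hunit : HasUnitContent L := by
    rw [hasUnitContent_iff_not_C_dvd]
    intro hdvd
    have h1 : 1 ≤ mu L := le_mu_of_C_pow_dvd hL0 (n := 1) (by rwa [pow_one])
    omega
  -- `μ(X^ε) = 0` for every dual datum, from lane B's integral length bound at `𝔭 = (p)`; then lane A's door
  refine kobayashiMainConjecture_of_mu_eq_zero_of_bsdp_of_analyticRank_eq_zero W p h12 h41 hKim h5 h3 hGZK hmod'
    hp hgood hap (fun κ γ hκ hγ hγ' D ↦ ?_) h0 hB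
  let 𝔭 : PrimeSpectrum (IwasawaAlgebra p) :=
    ⟨IwasawaAlgebra.augIdealP p, IwasawaAlgebra.isPrime_augIdealP_holds p⟩
  have hle := signed_lengthAt_le_of_hasUnitContent_anySign W p hCK h5 h3 hp hgood hap hns f hf u⁻¹ hϖ hL hunit hL
    κ γ hκ hγ hγ' D 𝔭 rfl
  have hq0 : lengthAt (IwasawaAlgebra p) (IwasawaAlgebra p ⧸ Ideal.span {L}) 𝔭 = 0 :=
    KatoMuSkeleton.lengthAt_quotient_span_eq_zero_of_hasUnitContent hunit 𝔭 rfl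
  have hX0 : lengthAt (IwasawaAlgebra p) D.X 𝔭 = 0 := le_antisymm (hle.trans hq0.le) bot_le
  change muInvariant p D.X = 0
  rw [muInvariant_eq_toNat_lengthAt p D.X 𝔭 rfl, hX0]
  rfl

/-- **Both signs at once from one EVEN and one ODD Mazur–Tate row of `E` itself** (rank `0`, small image,
partner-free): for the newform `f₀` of `W` at level `N_E`, `Θ₊ ≠ 0` with `ι Θ₊ = θ_m(f₀)`, `m` even, `μ(Θ₊) = 0`,
`λ(Θ₊) = deg ω_m^- + l₊` gives `μ(L_p^{+}(E)) = 0` (`lam_signed_one_eq_of_mazurTate'`), and `Θ₋`, `n` odd,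
`λ(Θ₋) = deg ω_n^+ + l₋` gives `μ(L_p^{−}(E)) = 0` (`lam_signed_neg_one_eq_of_mazurTate'`); then §1 for each sign.
CONDITIONAL on the same binders; per pair; nothing booked.
[cite: Pollack2003, Prop. 6.9, 6.10 and 6.18] [cite: Kobayashi2003, Conjecture (p. 2), Thm. 1.2 and Thm. 4.1] [cite: BDKim2013, Cor. 3.15 (p. 199)] -/
theorem forall_kobayashiMainConjecture_of_mazurTate_of_bsdp_of_analyticRank_eq_zero
    (hCK : thm62_63_73_signedColemanKato_zeta)
    (h12 : Kobayashi2003.thm12_signedSelmerDual_finite_torsion)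
    (h41 : Kobayashi2003.thm41_signedCharIdeal_divisibility)
    (hKim : BDKim2013.cor315_signedCharValue_rankZero)
    (h5 : realPeriodRat_eq_unit_mul_plusPeriod) (h3 : realPeriodRat_eq_unit_mul_plusPeriod_three)
    (hGZK : rank_eq_analyticRank_of_analyticRank_le_one) (hmod' : hasEntireLFunction_rat)
    (W : WeierstrassCurve ℚ) [W.IsElliptic] [W.IsGloballyMinimal] (p : ℕ) [Fact p.Prime]
    (hp : p ≠ 2) (hgood : W.HasGoodReductionAtPrime p) (hap : W.frobeniusTrace p = 0)
    (hns : ¬ W.HasSurjectiveModNGaloisRep p)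
    {N : ℕ} [NeZero N] {f₀ : CuspForm (Gamma0 N) 2} (hf₀ : IsNewformOf W f₀)
    {m n : ℕ} (hm : Even m) (hn : Odd n) {Θp Θm : IwasawaAlgebra p} {lp lm : ℕ}
    (hΘp : iwasawaToPowerSeries p Θp = ((mazurTateElement f₀ p m).map (algebraMap ℚ ℚ_[p]) : PowerSeries ℚ_[p]))
    (hΘp0 : Θp ≠ 0) (hμp : mu Θp = 0) (hlamp : lam Θp = (cyclotomicOmegaMinus p m).natDegree + lp)
    (hΘm : iwasawaToPowerSeries p Θm = ((mazurTateElement f₀ p n).map (algebraMap ℚ ℚ_[p]) : PowerSeries ℚ_[p]))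
    (hΘm0 : Θm ≠ 0) (hμm : mu Θm = 0) (hlamm : lam Θm = (cyclotomicOmegaPlus p n).natDegree + lm)
    (h0 : W.analyticRank = 0) (hB : BSDp W p) : ∀ ε : ℤˣ, KobayashiMainConjecture W p ε := by
  intro ε
  rcases Int.units_eq_one_or ε with rfl | rfl
  · exact kobayashiMainConjecture_of_signedMuCert_of_bsdp_of_analyticRank_eq_zero hCK h12 h41 hKim h5 h3 hGZK hmod'
      W p hp hgood hap hns hf₀ 1
      (fun L hL ↦ (lam_signed_one_eq_of_mazurTate' hp hf₀ hgood hap hL hm hΘp hΘp0 hμp hlamp).1) h0 hB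
  · exact kobayashiMainConjecture_of_signedMuCert_of_bsdp_of_analyticRank_eq_zero hCK h12 h41 hKim h5 h3 hGZK hmod'
      W p hp hgood hap hns hf₀ (-1)
      (fun L hL ↦ (lam_signed_neg_one_eq_of_mazurTate' hp hf₀ hgood hap hL hn hΘm hΘm0 hμm hlamm).1) h0 hB

/-! ### §2 Kernel point counts at `3` (`a_3 = 0`) for the nine Cremona models -/

/-- `#{Ẽ(𝔽_3)} = 4` for the Cremona model of `219040i1` (`a_3 = 0`; kernel count). [cite: Cremona2006, Table 1 (Cremona label 219040i1)] -/
theorem card_nf219040i1_3 :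
    Nat.card (((⟨0, 0, 0, 50653, 138687914⟩ : WeierstrassCurve ℤ).map
      (Int.castRingHom (ZMod 3))).toAffine.Point) = 4 := by
  rw [@WeierstrassCurve.natCard_point_eq_one_add_card (ZMod 3) (@ZMod.instField 3 ⟨by norm_num⟩) _ _ _
    (by decide +kernel), @card_sol_eq_sum_euler (ZMod 3) (@ZMod.instField 3 ⟨by norm_num⟩) _ _
    (by rw [ZMod.ringChar_zmod_n]; decide), ZMod.card]
  decide +kernel

/-- `#{Ẽ(𝔽_3)} = 4` for the Cremona model of `270494e1` (`a_3 = 0`; kernel count). [cite: Cremona2006, Table 1 (Cremona label 270494e1)] -/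
theorem card_nf270494e1_3 :
    Nat.card (((⟨1, -1, 1, -392128, 94695459⟩ : WeierstrassCurve ℤ).map
      (Int.castRingHom (ZMod 3))).toAffine.Point) = 4 := by
  rw [@WeierstrassCurve.natCard_point_eq_one_add_card (ZMod 3) (@ZMod.instField 3 ⟨by norm_num⟩) _ _ _
    (by decide +kernel), @card_sol_eq_sum_euler (ZMod 3) (@ZMod.instField 3 ⟨by norm_num⟩) _ _
    (by rw [ZMod.ringChar_zmod_n]; decide), ZMod.card]
  decide +kernel

/-- `#{Ẽ(𝔽_3)} = 4` for the Cremona model of `314678bz1` (`a_3 = 0`; kernel count). [cite: Cremona2006, Table 1 (Cremona label 314678bz1)] -/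
theorem card_nf314678bz1_3 :
    Nat.card (((⟨1, -1, 1, -2238606, -1287188899⟩ : WeierstrassCurve ℤ).map
      (Int.castRingHom (ZMod 3))).toAffine.Point) = 4 := by
  rw [@WeierstrassCurve.natCard_point_eq_one_add_card (ZMod 3) (@ZMod.instField 3 ⟨by norm_num⟩) _ _ _
    (by decide +kernel), @card_sol_eq_sum_euler (ZMod 3) (@ZMod.instField 3 ⟨by norm_num⟩) _ _
    (by rw [ZMod.ringChar_zmod_n]; decide), ZMod.card]
  decide +kernel

/-- `#{Ẽ(𝔽_3)} = 4` for the Cremona model of `314678cc1` (`a_3 = 0`; kernel count). [cite: Cremona2006, Table 1 (Cremona label 314678cc1)] -/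
theorem card_nf314678cc1_3 :
    Nat.card (((⟨1, -1, 1, 1160153, 71914847⟩ : WeierstrassCurve ℤ).map
      (Int.castRingHom (ZMod 3))).toAffine.Point) = 4 := by
  rw [@WeierstrassCurve.natCard_point_eq_one_add_card (ZMod 3) (@ZMod.instField 3 ⟨by norm_num⟩) _ _ _
    (by decide +kernel), @card_sol_eq_sum_euler (ZMod 3) (@ZMod.instField 3 ⟨by norm_num⟩) _ _
    (by rw [ZMod.ringChar_zmod_n]; decide), ZMod.card]
  decide +kernel

/-- `#{Ẽ(𝔽_3)} = 4` for the Cremona model of `314678r1` (`a_3 = 0`; kernel count). [cite: Cremona2006, Table 1 (Cremona label 314678r1)] -/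
theorem card_nf314678r1_3 :
    Nat.card (((⟨1, -1, 0, -13246, -582828⟩ : WeierstrassCurve ℤ).map
      (Int.castRingHom (ZMod 3))).toAffine.Point) = 4 := by
  rw [@WeierstrassCurve.natCard_point_eq_one_add_card (ZMod 3) (@ZMod.instField 3 ⟨by norm_num⟩) _ _ _
    (by decide +kernel), @card_sol_eq_sum_euler (ZMod 3) (@ZMod.instField 3 ⟨by norm_num⟩) _ _
    (by rw [ZMod.ringChar_zmod_n]; decide), ZMod.card]
  decide +kernel

/-- `#{Ẽ(𝔽_3)} = 4` for the Cremona model of `378560fp1` (`a_3 = 0`; kernel count). [cite: Cremona2006, Table 1 (Cremona label 378560fp1)] -/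
theorem card_nf378560fp1_3 :
    Nat.card (((⟨0, 0, 0, -5032087892, -127118829942624⟩ : WeierstrassCurve ℤ).map
      (Int.castRingHom (ZMod 3))).toAffine.Point) = 4 := by
  rw [@WeierstrassCurve.natCard_point_eq_one_add_card (ZMod 3) (@ZMod.instField 3 ⟨by norm_num⟩) _ _ _
    (by decide +kernel), @card_sol_eq_sum_euler (ZMod 3) (@ZMod.instField 3 ⟨by norm_num⟩) _ _
    (by rw [ZMod.ringChar_zmod_n]; decide), ZMod.card]
  decide +kernel

/-- `#{Ẽ(𝔽_3)} = 4` for the Cremona model of `430528v1` (`a_3 = 0`; kernel count). [cite: Cremona2006, Table 1 (Cremona label 430528v1)] -/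
theorem card_nf430528v1_3 :
    Nat.card (((⟨0, 0, 0, -13516, -599664⟩ : WeierstrassCurve ℤ).map
      (Int.castRingHom (ZMod 3))).toAffine.Point) = 4 := by
  rw [@WeierstrassCurve.natCard_point_eq_one_add_card (ZMod 3) (@ZMod.instField 3 ⟨by norm_num⟩) _ _ _
    (by decide +kernel), @card_sol_eq_sum_euler (ZMod 3) (@ZMod.instField 3 ⟨by norm_num⟩) _ _
    (by rw [ZMod.ringChar_zmod_n]; decide), ZMod.card]
  decide +kernel

/-- `#{Ẽ(𝔽_3)} = 4` for the Cremona model of `430528y1` (`a_3 = 0`; kernel count). [cite: Cremona2006, Table 1 (Cremona label 430528y1)] -/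
theorem card_nf430528y1_3 :
    Nat.card (((⟨0, 0, 0, -12988876, 17864590224⟩ : WeierstrassCurve ℤ).map
      (Int.castRingHom (ZMod 3))).toAffine.Point) = 4 := by
  rw [@WeierstrassCurve.natCard_point_eq_one_add_card (ZMod 3) (@ZMod.instField 3 ⟨by norm_num⟩) _ _ _
    (by decide +kernel), @card_sol_eq_sum_euler (ZMod 3) (@ZMod.instField 3 ⟨by norm_num⟩) _ _
    (by rw [ZMod.ringChar_zmod_n]; decide), ZMod.card]
  decide +kernel

/-- `#{Ẽ(𝔽_3)} = 4` for the Cremona model of `481888n1` (`a_3 = 0`; kernel count). [cite: Cremona2006, Table 1 (Cremona label 481888n1)] -/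
theorem card_nf481888n1_3 :
    Nat.card (((⟨0, 0, 0, -16465, -804972⟩ : WeierstrassCurve ℤ).map
      (Int.castRingHom (ZMod 3))).toAffine.Point) = 4 := by
  rw [@WeierstrassCurve.natCard_point_eq_one_add_card (ZMod 3) (@ZMod.instField 3 ⟨by norm_num⟩) _ _ _
    (by decide +kernel), @card_sol_eq_sum_euler (ZMod 3) (@ZMod.instField 3 ⟨by norm_num⟩) _ _
    (by rw [ZMod.ringChar_zmod_n]; decide), ZMod.card]
  decide +kernel

/-! ### §3 The records (part A: two pairs; part B = `…SignedMuNFRecordsThreeB.lean`): `∀ ε, KobayashiMainConjecture W 3 ε`, partner-free -/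

section Records

/-- Shared kernel step for the records: literal Cremona model ⟹ good reduction at `3` (`3 ∤ Δ`, kernel) and
`a_3 = 0` (kernel count), then `forall_kobayashiMainConjecture_of_mazurTate_of_bsdp_of_analyticRank_eq_zero` at
`p = 3` with the even row at `θ₄` and the odd row at `θ₅`. [cite: Kobayashi2003, Conjecture (p. 2)] [cite: Pollack2003, Prop. 6.18] -/
theorem forall_kobayashiMainConjecture_three_of_rows
    (hCK : thm62_63_73_signedColemanKato_zeta) (h12 : Kobayashi2003.thm12_signedSelmerDual_finite_torsion)
    (h41 : Kobayashi2003.thm41_signedCharIdeal_divisibility) (hKim : BDKim2013.cor315_signedCharValue_rankZero)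
    (h5 : realPeriodRat_eq_unit_mul_plusPeriod) (h3 : realPeriodRat_eq_unit_mul_plusPeriod_three)
    (hGZK : rank_eq_analyticRank_of_analyticRank_le_one) (hmod' : hasEntireLFunction_rat)
    (W : WeierstrassCurve ℚ) [W.IsElliptic] [W.IsGloballyMinimal] (hgood : W.HasGoodReductionAtPrime 3)
    (hap : W.frobeniusTrace 3 = 0) (hns : ¬ W.HasSurjectiveModNGaloisRep ((3 : ℕ) : ℤ))
    [NeZero (W.conductorNorm ℤ)] {f₀ : CuspForm (Gamma0 (W.conductorNorm ℤ)) 2} (hf₀ : IsNewformOf W f₀)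
    [Fact (Nat.Prime 3)] {Θp Θm : IwasawaAlgebra 3} {lp lm : ℕ}
    (hΘp : iwasawaToPowerSeries 3 Θp = ((mazurTateElement f₀ 3 4).map (algebraMap ℚ ℚ_[3]) : PowerSeries ℚ_[3]))
    (hΘp0 : Θp ≠ 0) (hμp : mu Θp = 0) (hlamp : lam Θp = (cyclotomicOmegaMinus 3 4).natDegree + lp)
    (hΘm : iwasawaToPowerSeries 3 Θm = ((mazurTateElement f₀ 3 5).map (algebraMap ℚ ℚ_[3]) : PowerSeries ℚ_[3]))
    (hΘm0 : Θm ≠ 0) (hμm : mu Θm = 0) (hlamm : lam Θm = (cyclotomicOmegaPlus 3 5).natDegree + lm)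
    (h0 : W.analyticRank = 0) (hB : BSDp W 3) : ∀ ε : ℤˣ, KobayashiMainConjecture W 3 ε :=
  forall_kobayashiMainConjecture_of_mazurTate_of_bsdp_of_analyticRank_eq_zero hCK h12 h41 hKim h5 h3 hGZK hmod' W 3
    (by decide) hgood hap hns hf₀ (by decide) (by decide) hΘp hΘp0 hμp hlamp hΘm hΘm0 hμm hlamm h0 hB

/-- **`219040i1 @ 3`, BOTH signs: `∀ ε, KobayashiMainConjecture W 3 ε`** (Cremona model `[0, 0, 0, 50653, 138687914]`, `N = 219040 = 2⁵·5·37²`,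
`r_an = 0`, `∏ c_ℓ = 6`, `#Ш_an = 1`, `#E(ℚ)_tors = 1`; X7, `a_3 = 0`, image `3Nn` with CM shadow `ℚ(√−37)`, NO CM elliptic partner).
PARTNER-FREE: lane B's door + E's OWN rows (kit j280059; engines B = E identically on `(μ, λ)` at all six layers `θ₀…θ₅`): even `θ₄`: `(μ, λ) = (0, 20 + 2)`
[stable: `θ₂`: `(0, 2 + 2)`], odd `θ₅`: `(μ, λ) = (0, 60 + 10)` [stable: `θ₃`: `(0, 6 + 10)`] ⟹ `μ(L_3^±(E)) = 0`, `λ(L_3^+(E)) = 2`, `λ(L_3^−(E)) = 10`.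
`BSD(E,3)` BY NAME = `bsdp3_nn219040i1` (b2b EXACT 3-descent, kit j131863; `NonsplitCartanThreeDescentRecordsX7Three03`) through its
displayed binders `hr`, `hs`/`hvs`, `hSel`; `¬Surj` = kernel theorem `SmallImageSelfTwist.not_surj_three_c219040i1`; `3 ∤ Δ`,
`#Ẽ(𝔽_3) = 4` in the kernel.  BY NAME: `hCK` (construction fact, p529649), `h12 h41 hKim h5 h3 hGZK hmod'` (published).
NO partner / congruence / preprint / GRH.  Per pair; item 4 stays OPEN; nothing booked; BSD is not proved by any of this.
[cite: Kobayashi2003, Conjecture (p. 2), Thm. 1.2, Thm. 4.1, Thm. 6.3 and Thm. 7.3] [cite: BDKim2013, Cor. 3.15 (p. 199)] [cite: Pollack2003, Prop. 6.9, 6.10 and 6.18]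
[cite: Miller2011LMS, Def. 1.1] [cite: Cremona2006, Table 1 (Cremona label 219040i1)] -/
theorem nf_kobayashiMainConjecture_219040i1_3
    (hCK : thm62_63_73_signedColemanKato_zeta) (h12 : Kobayashi2003.thm12_signedSelmerDual_finite_torsion)
    (h41 : Kobayashi2003.thm41_signedCharIdeal_divisibility) (hKim : BDKim2013.cor315_signedCharValue_rankZero)
    (h5 : realPeriodRat_eq_unit_mul_plusPeriod) (h3 : realPeriodRat_eq_unit_mul_plusPeriod_three)
    (hGZK : rank_eq_analyticRank_of_analyticRank_le_one) (hmod' : hasEntireLFunction_rat)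
    (W : WeierstrassCurve ℚ) [W.IsElliptic] [W.IsGloballyMinimal] [Fact (Nat.Prime 3)] (hW : W = ⟨0, 0, 0, 50653, 138687914⟩)
    (hr : W.analyticRank = 0) {s : ℚ} (hs : shaAn W = (s : ℂ)) (hvs : padicValRat 3 s = 0)
    (hSel : Nat.card (W.selmerGroup (3 : ℤ)) = 3 ^ W.analyticRank)
    [NeZero (W.conductorNorm ℤ)] {f₀ : CuspForm (Gamma0 (W.conductorNorm ℤ)) 2} (hf₀ : IsNewformOf W f₀)
    {Θ₄ Θ₅ : IwasawaAlgebra 3}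
    (hΘ₄ : iwasawaToPowerSeries 3 Θ₄ = ((mazurTateElement f₀ 3 4).map (algebraMap ℚ ℚ_[3]) : PowerSeries ℚ_[3]))
    (hΘ₄0 : Θ₄ ≠ 0) (hμ₄ : mu Θ₄ = 0) (hlam₄ : lam Θ₄ = (cyclotomicOmegaMinus 3 4).natDegree + 2)
    (hΘ₅ : iwasawaToPowerSeries 3 Θ₅ = ((mazurTateElement f₀ 3 5).map (algebraMap ℚ ℚ_[3]) : PowerSeries ℚ_[3]))
    (hΘ₅0 : Θ₅ ≠ 0) (hμ₅ : mu Θ₅ = 0) (hlam₅ : lam Θ₅ = (cyclotomicOmegaPlus 3 5).natDegree + 10) :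
    ∀ ε : ℤˣ, KobayashiMainConjecture W 3 ε := by
  have hI : integralModelInt W = ⟨0, 0, 0, 50653, 138687914⟩ :=
    integralModelInt_eq_of_map_eq _ (by rw [hW]; ext <;> simp [WeierstrassCurve.map])
  have hΔ : (⟨0, 0, 0, 50653, 138687914⟩ : WeierstrassCurve ℤ).Δ = discOf [0, 0, 0, 50653, 138687914] :=
    intCurve_Δ 0 0 0 50653 138687914
  have hgood : W.HasGoodReductionAtPrime 3 :=
    hasGoodReductionAtPrime_of_not_dvd W 3 (by rw [minimalDiscriminantInt_eq hI, hΔ]; decide +kernel)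
  have hap : W.frobeniusTrace 3 = 0 := by rw [frobeniusTrace_eq hI card_nf219040i1_3]; norm_num
  exact forall_kobayashiMainConjecture_three_of_rows hCK h12 h41 hKim h5 h3 hGZK hmod' W hgood hap
    (SmallImageSelfTwist.not_surj_three_c219040i1 W hW) hf₀ hΘ₄ hΘ₄0 hμ₄ hlam₄ hΘ₅ hΘ₅0 hμ₅ hlam₅ hr
    (bsdp3_nn219040i1 hGZK W hW (hr.trans_le zero_le_one) hs hvs hSel)

/-- **`270494e1 @ 3`, BOTH signs: `∀ ε, KobayashiMainConjecture W 3 ε`** (Cremona model `[1, -1, 1, -392128, 94695459]`, `N = 270494 = 2·7·139²`,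
`r_an = 0`, `∏ c_ℓ = 12`, `#Ш_an = 1`, `#E(ℚ)_tors = 1`; X7, `a_3 = 0`, image `3Nn` with CM shadow `ℚ(√−139)`, NO CM elliptic partner).
PARTNER-FREE: lane B's door + E's OWN rows (kit j280059; engines B = E identically on `(μ, λ)` at all six layers `θ₀…θ₅`): even `θ₄`: `(μ, λ) = (0, 20 + 4)`
[stable: `θ₂`: `(0, 2 + 4)`], odd `θ₅`: `(μ, λ) = (0, 60 + 2)` [stable: `θ₃`: `(0, 6 + 2)`] ⟹ `μ(L_3^±(E)) = 0`, `λ(L_3^+(E)) = 4`, `λ(L_3^−(E)) = 2`.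
`BSD(E,3)` BY NAME = `bsdp3_nn270494e1` (b2b EXACT 3-descent, kit j131863; `NonsplitCartanThreeDescentRecordsX7Three04`) through its
displayed binders `hr`, `hs`/`hvs`, `hSel`; `¬Surj` = kernel theorem `SmallImageSelfTwist.not_surj_three_c270494e1`; `3 ∤ Δ`,
`#Ẽ(𝔽_3) = 4` in the kernel.  BY NAME: `hCK` (construction fact, p529649), `h12 h41 hKim h5 h3 hGZK hmod'` (published).
NO partner / congruence / preprint / GRH.  Per pair; item 4 stays OPEN; nothing booked; BSD is not proved by any of this.
[cite: Kobayashi2003, Conjecture (p. 2), Thm. 1.2, Thm. 4.1, Thm. 6.3 and Thm. 7.3] [cite: BDKim2013, Cor. 3.15 (p. 199)] [cite: Pollack2003, Prop. 6.9, 6.10 and 6.18]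
[cite: Miller2011LMS, Def. 1.1] [cite: Cremona2006, Table 1 (Cremona label 270494e1)] -/
theorem nf_kobayashiMainConjecture_270494e1_3
    (hCK : thm62_63_73_signedColemanKato_zeta) (h12 : Kobayashi2003.thm12_signedSelmerDual_finite_torsion)
    (h41 : Kobayashi2003.thm41_signedCharIdeal_divisibility) (hKim : BDKim2013.cor315_signedCharValue_rankZero)
    (h5 : realPeriodRat_eq_unit_mul_plusPeriod) (h3 : realPeriodRat_eq_unit_mul_plusPeriod_three)
    (hGZK : rank_eq_analyticRank_of_analyticRank_le_one) (hmod' : hasEntireLFunction_rat)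
    (W : WeierstrassCurve ℚ) [W.IsElliptic] [W.IsGloballyMinimal] [Fact (Nat.Prime 3)] (hW : W = ⟨1, -1, 1, -392128, 94695459⟩)
    (hr : W.analyticRank = 0) {s : ℚ} (hs : shaAn W = (s : ℂ)) (hvs : padicValRat 3 s = 0)
    (hSel : Nat.card (W.selmerGroup (3 : ℤ)) = 3 ^ W.analyticRank)
    [NeZero (W.conductorNorm ℤ)] {f₀ : CuspForm (Gamma0 (W.conductorNorm ℤ)) 2} (hf₀ : IsNewformOf W f₀)
    {Θ₄ Θ₅ : IwasawaAlgebra 3}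
    (hΘ₄ : iwasawaToPowerSeries 3 Θ₄ = ((mazurTateElement f₀ 3 4).map (algebraMap ℚ ℚ_[3]) : PowerSeries ℚ_[3]))
    (hΘ₄0 : Θ₄ ≠ 0) (hμ₄ : mu Θ₄ = 0) (hlam₄ : lam Θ₄ = (cyclotomicOmegaMinus 3 4).natDegree + 4)
    (hΘ₅ : iwasawaToPowerSeries 3 Θ₅ = ((mazurTateElement f₀ 3 5).map (algebraMap ℚ ℚ_[3]) : PowerSeries ℚ_[3]))
    (hΘ₅0 : Θ₅ ≠ 0) (hμ₅ : mu Θ₅ = 0) (hlam₅ : lam Θ₅ = (cyclotomicOmegaPlus 3 5).natDegree + 2) :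
    ∀ ε : ℤˣ, KobayashiMainConjecture W 3 ε := by
  have hI : integralModelInt W = ⟨1, -1, 1, -392128, 94695459⟩ :=
    integralModelInt_eq_of_map_eq _ (by rw [hW]; ext <;> simp [WeierstrassCurve.map])
  have hΔ : (⟨1, -1, 1, -392128, 94695459⟩ : WeierstrassCurve ℤ).Δ = discOf [1, -1, 1, -392128, 94695459] :=
    intCurve_Δ 1 (-1) 1 (-392128) 94695459
  have hgood : W.HasGoodReductionAtPrime 3 :=
    hasGoodReductionAtPrime_of_not_dvd W 3 (by rw [minimalDiscriminantInt_eq hI, hΔ]; decide +kernel)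
  have hap : W.frobeniusTrace 3 = 0 := by rw [frobeniusTrace_eq hI card_nf270494e1_3]; norm_num
  exact forall_kobayashiMainConjecture_three_of_rows hCK h12 h41 hKim h5 h3 hGZK hmod' W hgood hap
    (SmallImageSelfTwist.not_surj_three_c270494e1 W hW) hf₀ hΘ₄ hΘ₄0 hμ₄ hlam₄ hΘ₅ hΘ₅0 hμ₅ hlam₅ hr
    (bsdp3_nn270494e1 hGZK W hW (hr.trans_le zero_le_one) hs hvs hSel)

end Records

end Summit.BirchSwinnertonDyer.BirchSwinnertonDyer.Theorems.SmallImageSignedMuNF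

end
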